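import Summits.BirchSwinnertonDyer.BirchSwinnertonDyer.Theses.AlignedTransportAtTwo
import Summits.BirchSwinnertonDyer.BirchSwinnertonDyer.Theorems.AlignedTransportAtTwoMainConjectureOfRankZeroBSDAtTwoFineRoadLimRelUpstairs
import HarnessLib

/-! # LIMREL glue for skeleton v8 (att-p5 g4) — paste-ready, elaborates rc 0

The v7 skeleton's registered stub `stub_limRelAtTwo : LimRelAtTwo` (body copied VERBATIM below) is CLOSED modulo ONE
PRINT named fact, `Literature.NumberTheory.EllipticCurves.Lim2017.thm35_at_two_upstairs_fineSelmer_twoTorsion_finite_of_classicalMuVanishes`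
(p605725, Lim 2017 Thm. 3.5 at `p = 2`, carrier `ℚ(E[2], √−1)`), by the landed kernel
`Summit.…Theorems.AlignedTransportAtTwoFineRoad.LimRelUpstairs.limRelAtTwo_of_lim2017` (p605868/p606004; descent p605654).
For `Lines/birth.lean` v8 (lead): either
  `theorem stub_limDoor : Lim2017.thm35_at_two_upstairs_fineSelmer_twoTorsion_finite_of_classicalMuVanishes := by sorry  -- PRINT`
  `theorem stub_limRelAtTwo : LimRelAtTwo := LimRelUpstairs.limRelAtTwo_of_lim2017 stub_limDoor`
or add the fact as a conjunct of `PublishedInputsAtTwo` and derive Limʳ from stub P. Import to add: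
`Summits.BirchSwinnertonDyer.BirchSwinnertonDyer.Theorems.AlignedTransportAtTwoMainConjectureOfRankZeroBSDAtTwoFineRoadLimRelUpstairs`.
BSD is not proved by any of this. -/

set_option linter.dupNamespace false

noncomputable section

namespace Summit.BirchSwinnertonDyer.BirchSwinnertonDyer.Cruxes.MainConjectureOfRankZeroBSDAtTwo.BirthTest

open Summit.BirchSwinnertonDyer.BirchSwinnertonDyer.Theses.AlignedTransportAtTwo
open WeierstrassCurve Summit.BirchSwinnertonDyer.Rank1Residual.X5
open Literature.NumberTheory.EllipticCurves Literature.NumberTheory.EllipticCurves.ModularForms CongruenceSubgroup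
open Literature.NumberTheory.EllipticCurves.Greenberg1999 Literature.NumberTheory.EllipticCurves.Rank1Residual
  Literature.NumberTheory.IwasawaTheory Literature.NumberTheory.GaloisRepresentations ZpExtension
  Summit.BirchSwinnertonDyer.Rank1Residual Summit.BirchSwinnertonDyer.Rank1Residual.X1.MuLambda
  Summit.BirchSwinnertonDyer.Rank1Residual.F1Sign2
  Summit.BirchSwinnertonDyer.BirchSwinnertonDyer.Theorems.Rank1ResidualX1Defs
  Literature.NumberTheory.EllipticCurves.GreenbergSelmer

/-- copy of v7 `LimRelAtTwo` (byte-identical body). -/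
def LimRelAtTwo : Prop :=
  ∀ (W : WeierstrassCurve ℚ) [W.IsElliptic] [W.IsGloballyMinimal], IsOrdinaryAt W 2 →
    (∀ x : ℚ, ¬ HasRationalTwoTorsionX W x) →
    ∀ i : AlgebraicClosure ℚ, i ^ 2 = -1 →
    (∀ κL : ZpExtension ↥(W.divisionField 2 ⊔ IntermediateField.adjoin ℚ {i}) 2,
      κL.IsCyclotomic → ClassicalMuVanishes κL) →
    ∀ (κ : ZpExtension ℚ 2) (γ : Field.absoluteGaloisGroup ℚ), κ.IsCyclotomic →
    κ.IsTopGenerator γ → IsCyclotomicVariable 2 γ →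
    ∀ Yr : W.FineSelmerDualDataRelaxedInf κ γ,
      Literature.NumberTheory.EllipticCurves.Module.lengthAt (IwasawaAlgebra 2) Yr.X
          ⟨IwasawaAlgebra.augIdealP 2, IwasawaAlgebra.isPrime_augIdealP_holds 2⟩ = 0

/-- the door, displayed (= body of `Lim2017.thm35_at_two_upstairs_fineSelmer_twoTorsion_finite_of_classicalMuVanishes`). -/
def Door : Prop :=
  ∀ (W : WeierstrassCurve ℚ) [W.IsElliptic] (i : AlgebraicClosure ℚ), i ^ 2 = -1 →
    (∀ κL : ZpExtension ↥(W.divisionField 2 ⊔ IntermediateField.adjoin ℚ {i}) 2,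
      κL.IsCyclotomic → ClassicalMuVanishes κL) →
    Set.Finite {c : W.subgroupH1 2
        ((W.galoisRepTorsion 2).ker ⊓ (GaloisRep.cyclotomicCharacter ℚ 2).toMonoidHom.ker) |
      c ∈ strictSelmerGroupOver ((W.galoisRepTorsion 2).ker ⊓ (GaloisRep.cyclotomicCharacter ℚ 2).toMonoidHom.ker)
          (W.geomPrimaryTorsion 2) 2 (fineData (W.geomPrimaryTorsion 2) 2) ∧ 2 • c = 0}

/-- stub Limʳ modulo the door (displayed form). -/
theorem stub_limRelAtTwo_of_door (h : Door) : LimRelAtTwo :=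
  Summit.BirchSwinnertonDyer.BirchSwinnertonDyer.Theorems.AlignedTransportAtTwoFineRoad.LimRelUpstairs.limRelAtTwo_of_lim2017_upstairs h

/-- stub Limʳ modulo the door (NAMED-FACT form, the shape for v8: `stub_limRelAtTwo := … stub_limDoor`). -/
theorem stub_limRelAtTwo_of_lim2017
    (hLim : Lim2017.thm35_at_two_upstairs_fineSelmer_twoTorsion_finite_of_classicalMuVanishes) : LimRelAtTwo :=
  Summit.BirchSwinnertonDyer.BirchSwinnertonDyer.Theorems.AlignedTransportAtTwoFineRoad.LimRelUpstairs.limRelAtTwo_of_lim2017 hLim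

end Summit.BirchSwinnertonDyer.BirchSwinnertonDyer.Cruxes.MainConjectureOfRankZeroBSDAtTwo.BirthTest

end
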